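import Summits.Ventures.HSemireg.WedgeHankelRecurrenceCompleteIntersection

/-!
# Venture HSemireg — THE DEGREE OF THE SECOND GENERATOR DETECTS THE NODE AT `∞`: for `R^N(q) = r ≥ 1`, `2r ≤ N + 1` and the monic minimal recurrence `m` (`Rec^N_r(q) = K·m`),
# **an AFFINE class (`deg m = r`) has a second generator of degree `< r` (any second generator reduced mod `m` — N41's `a⁻¹ mod m` up to a scalar), a POLAR class (`deg m < r`) has only second
# generators of full degree `N + 2 − r` (N56); so `q` is polar ⟺ every `g ∈ Rec_{N+2−r}(q) ∖ m·K[X]_{≤ N+2−2r}` has degree `N + 2 − r` ⟺ none has degree `< r`**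

HONEST FRAMING. Part of the Lean index of the computation cell `pub-hsemireg` (seat p10 gen 29, Sunday typer «UNIFORM-IN-n»).
LINEAR ALGEBRA OF HANKEL (catalecticant) MATRICES and of polynomials over a field ONLY: no variety, no cohomology theory, no sheaf, no Ext group and no semiregularity map is constructed
here; nothing here says that HC / HC_CM / HC_AV holds; no Literature fact is declared or used.  Custodian versions as in `WedgeHankelSiegelIdeal` (1/3); the dictionary («second generator of
the apolar complete intersection», «node at `∞`») is QUOTED, never asserted.

WHAT IS IN THE TREE / CHAINED.  N56 (`WedgeHankelRecurrenceCompleteIntersection`, this generation): `exists_mem_recSpace_not_mem_map_mulRight`, `natDegree_eq_of_not_mem_of_natDegree_lt`,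
`isCoprime_of_not_mem`; N43 (№ 323): `IsAffineClass`, `IsPolarClass`, `isAffineClass_or_isPolarClass`, `IsAffineClass.not_isPolarClass`, `natDegree_eq_of_mem_recSpace_self`; N18 (№ 173):
`map_mulRight_degreeLT_le_recSpace`, `mem_degreeLT_succ_iff`, `natDegree_le_of_mem_recSpace`, `recSpace_le_degreeLT`.  Mathlib: `Polynomial.modByMonic_add_div`, `Polynomial.natDegree_divByMonic`,
`Polynomial.degree_modByMonic_lt`.
THIS FILE (namespace `Summit.Ventures.HSemireg.Wedge.HankelOuter` continued; CHAINED on N56; 0 definitions):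
* §588 `not_mem_map_mulRight_degreeLT_of_natDegree_lt` (`b ≠ 0`, `deg b < deg m ⇒ b ∉ m·K[X]_{≤ n}`), **`modByMonic_mem_recSpace_beyond`** (`m` monic of degree `r` in `Rec_r(q)`, `g ∈ Rec_{N+2−r}(q) ⇒
  g mod m ∈ Rec_{N+2−r}(q)`), `modByMonic_not_mem_map_mulRight` (and `g mod m ∉ m·K[X]_{≤ N+2−2r}` if `g ∉`).
* §589 **`exists_second_generator_natDegree_lt`** (AFFINE, `deg m = r`: a second generator of degree `< r` exists), `natDegree_eq_of_second_generator_of_natDegree_lt` (POLAR, `deg m < r`: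
  every second generator has degree `N + 2 − r` — N56 recalled), and the dichotomy for a class of rank `r` with monic minimal recurrence `m`: **`isPolarClass_iff_forall_natDegree_eq`**
  (`q` polar ⟺ every second generator has degree `N + 2 − r`), **`isAffineClass_iff_exists_natDegree_lt`** (`q` affine ⟺ some second generator has degree `< r`).
Nothing Ext-side.  New names only.
-/

open Module Polynomial
open scoped Matrix Polynomial

namespace Summit.Ventures.HSemireg.Wedge.HankelOuter

open Summit.Ventures.HSemireg.Wedge Summit.Ventures.HSemireg.Wedge.Hankel

variable (K : Type*) [Field K] {N : ℕ}

/-! ## §588. Reducing a second generator modulo the minimal recurrence -/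

/-- a non-zero polynomial of degree `< deg m` is not a multiple of `m`: `b ∉ m·K[X]_{< n}`. -/
theorem not_mem_map_mulRight_degreeLT_of_natDegree_lt {m b : K[X]} (hb0 : b ≠ 0) (hb : b.natDegree < m.natDegree) (n : ℕ) :
    b ∉ (Polynomial.degreeLT K n).map (LinearMap.mulRight K m) := by
  rintro ⟨h, -, hbh⟩
  rw [LinearMap.mulRight_apply] at hbh
  have hh0 : h ≠ 0 := by rintro rfl; exact hb0 (by rw [← hbh, zero_mul])
  have hm0 : m ≠ 0 := by rintro rfl; exact hb0 (by rw [← hbh, mul_zero])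
  have := Polynomial.natDegree_mul hh0 hm0
  rw [hbh] at this
  omega

/-- **REDUCTION MOD `m` STAYS A RECURRENCE: for `m` monic of degree `r` in `Rec_r(q)` and `g ∈ Rec_{N+2−r}(q)` (`2r ≤ N + 2`), `g mod m ∈ Rec_{N+2−r}(q)`** (`g − g mod m = m·(g / m)` with
`deg (g / m) ≤ N + 2 − 2r` lies in `m·K[X]_{≤ N+2−2r} ⊆ Rec_{N+2−r}(q)`). -/
theorem modByMonic_mem_recSpace_beyond {r : ℕ} {q : ℕ → K} {m g : K[X]} (hm : m.Monic) (hmr : m.natDegree = r) (hmem : m ∈ recSpace K N q r) (h2 : r + r ≤ N + 2)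
    (hg : g ∈ recSpace K N q (N + 2 - r)) : g %ₘ m ∈ recSpace K N q (N + 2 - r) := by
  have hdiv : m * (g /ₘ m) ∈ recSpace K N q (N + 2 - r) := by
    have hle : (Polynomial.degreeLT K (N + 2 - r - r + 1)).map (LinearMap.mulRight K m) ≤ recSpace K N q (N + 2 - r) := by
      have h := map_mulRight_degreeLT_le_recSpace K hmem (N + 2 - r - r)
      rwa [show r + (N + 2 - r - r) = N + 2 - r by omega] at h
    refine hle ⟨g /ₘ m, ?_, by rw [LinearMap.mulRight_apply, mul_comm]⟩
    rw [SetLike.mem_coe, mem_degreeLT_succ_iff, Polynomial.natDegree_divByMonic g hm, hmr]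
    have := natDegree_le_of_mem_recSpace K hg
    omega
  have h := Submodule.sub_mem _ hg hdiv
  rwa [show g - m * (g /ₘ m) = g %ₘ m from sub_eq_of_eq_add (Polynomial.modByMonic_add_div g m).symm] at h

/-- … and it is still NOT accounted for by `m`: `g ∉ m·K[X]_{≤ N+2−2r} ⇒ g mod m ∉ m·K[X]_{≤ N+2−2r}` (the difference is). -/
theorem modByMonic_not_mem_map_mulRight {r : ℕ} {q : ℕ → K} {m g : K[X]} (hm : m.Monic) (hmr : m.natDegree = r) (hg : g ∈ recSpace K N q (N + 2 - r))
    (hgA : g ∉ (Polynomial.degreeLT K (N + 2 - r - r + 1)).map (LinearMap.mulRight K m)) : g %ₘ m ∉ (Polynomial.degreeLT K (N + 2 - r - r + 1)).map (LinearMap.mulRight K m) := by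
  intro h
  refine hgA ?_
  have hdiv : m * (g /ₘ m) ∈ (Polynomial.degreeLT K (N + 2 - r - r + 1)).map (LinearMap.mulRight K m) := by
    refine ⟨g /ₘ m, ?_, by rw [LinearMap.mulRight_apply, mul_comm]⟩
    rw [SetLike.mem_coe, mem_degreeLT_succ_iff, Polynomial.natDegree_divByMonic g hm, hmr]
    have := natDegree_le_of_mem_recSpace K hg
    omega
  have hsum := Submodule.add_mem _ h hdiv
  rwa [Polynomial.modByMonic_add_div] at hsum

/-! ## §589. Affine: a second generator of degree `< r`; polar: only full degree; the dichotomy -/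

/-- **AN AFFINE CLASS HAS A SECOND GENERATOR OF DEGREE `< r`: `R^N(q) = r ≥ 1`, `2r ≤ N + 1`, `m` monic of degree `r` in `Rec_r(q) ⇒ ∃ g ∈ Rec_{N+2−r}(q) ∖ m·K[X]_{≤ N+2−2r}` with `deg g < r`**
(N56's second generator reduced mod `m`; by N56's uniqueness it is N41's `a⁻¹ mod m` up to a scalar). -/
theorem exists_second_generator_natDegree_lt {r : ℕ} {q : ℕ → K} {m : K[X]} (hq : (hankel1 K N (N / 2) q).rank = r) (hr : 1 ≤ r) (h2 : r + r ≤ N + 1) (hm : m.Monic) (hmr : m.natDegree = r)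
    (hmem : m ∈ recSpace K N q r) :
    ∃ g ∈ recSpace K N q (N + 2 - r), g ∉ (Polynomial.degreeLT K (N + 2 - r - r + 1)).map (LinearMap.mulRight K m) ∧ g.natDegree < r := by
  obtain ⟨g, hg, hgA⟩ := exists_mem_recSpace_not_mem_map_mulRight K (m := m) hq hr h2 hm.ne_zero
  have hg0 : g %ₘ m ≠ 0 := by
    intro h0; exact modByMonic_not_mem_map_mulRight K hm hmr hg hgA (by rw [h0]; exact Submodule.zero_mem _)
  refine ⟨g %ₘ m, modByMonic_mem_recSpace_beyond K hm hmr hmem (by omega) hg, modByMonic_not_mem_map_mulRight K hm hmr hg hgA, ?_⟩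
  rw [← hmr]
  exact (Polynomial.natDegree_lt_iff_degree_lt hg0).mpr (by rw [← Polynomial.degree_eq_natDegree hm.ne_zero]; exact Polynomial.degree_modByMonic_lt g hm)

/-- **A POLAR CLASS HAS NO SECOND GENERATOR OF DEGREE `< N + 2 − r`** (N56, recalled in the present normalisation: `m` monic in `Rec_r(q)` with `deg m < r`). -/
theorem natDegree_eq_of_second_generator_of_natDegree_lt {r : ℕ} {q : ℕ → K} {m g : K[X]} (hq : (hankel1 K N (N / 2) q).rank = r) (h2 : r + r ≤ N + 1) (hm : m.Monic)
    (hmr : m.natDegree < r) (hmem : m ∈ recSpace K N q r) (hg : g ∈ recSpace K N q (N + 2 - r)) (hgA : g ∉ (Polynomial.degreeLT K (N + 2 - r - r + 1)).map (LinearMap.mulRight K m)) :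
    g.natDegree = N + 2 - r :=
  natDegree_eq_of_not_mem_of_natDegree_lt K hq h2 hmem hm.ne_zero hmr hg hgA

/-- **THE DICHOTOMY, POLAR SIDE: a class `q` of rank `r ≥ 1` (`2r ≤ N + 1`) with monic minimal recurrence `m` (`m ∈ Rec_r(q)`) is POLAR iff every second generator
`g ∈ Rec_{N+2−r}(q) ∖ m·K[X]_{≤ N+2−2r}` has full degree `N + 2 − r`.** -/
theorem isPolarClass_iff_forall_natDegree_eq {r : ℕ} {q : ℕ → K} {m : K[X]} (hq : (hankel1 K N (N / 2) q).rank = r) (hr : 1 ≤ r) (h2 : r + r ≤ N + 1) (hm : m.Monic)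
    (hmem : m ∈ recSpace K N q r) :
    IsPolarClass K N r q ↔ ∀ g ∈ recSpace K N q (N + 2 - r), g ∉ (Polynomial.degreeLT K (N + 2 - r - r + 1)).map (LinearMap.mulRight K m) → g.natDegree = N + 2 - r := by
  constructor
  · intro hP g hg hgA
    exact natDegree_eq_of_second_generator_of_natDegree_lt K hq h2 hm (hP.2 m hmem hm.ne_zero) hmem hg hgA
  · intro h
    rcases isAffineClass_or_isPolarClass K hq with hA | hP
    · exfalso
      obtain ⟨-, m', hm', hm'0, hm'r⟩ := hA
      have hmr : m.natDegree = r := by rw [← hm'r]; exact natDegree_eq_of_mem_recSpace_self K hq h2 hm' hm'0 hmem hm.ne_zero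
      obtain ⟨g, hg, hgA, hdeg⟩ := exists_second_generator_natDegree_lt K hq hr h2 hm hmr hmem
      have := h g hg hgA
      omega
    · exact hP

/-- **THE DICHOTOMY, AFFINE SIDE: `q` is AFFINE iff some second generator has degree `< r`** (equivalently, degree `< N + 2 − r`). -/
theorem isAffineClass_iff_exists_natDegree_lt {r : ℕ} {q : ℕ → K} {m : K[X]} (hq : (hankel1 K N (N / 2) q).rank = r) (hr : 1 ≤ r) (h2 : r + r ≤ N + 1) (hm : m.Monic)
    (hmem : m ∈ recSpace K N q r) :
    IsAffineClass K N r q ↔ ∃ g ∈ recSpace K N q (N + 2 - r), g ∉ (Polynomial.degreeLT K (N + 2 - r - r + 1)).map (LinearMap.mulRight K m) ∧ g.natDegree < r := by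
  constructor
  · rintro ⟨-, m', hm', hm'0, hm'r⟩
    have hmr : m.natDegree = r := by rw [← hm'r]; exact natDegree_eq_of_mem_recSpace_self K hq h2 hm' hm'0 hmem hm.ne_zero
    exact exists_second_generator_natDegree_lt K hq hr h2 hm hmr hmem
  · rintro ⟨g, hg, hgA, hdeg⟩
    rcases isAffineClass_or_isPolarClass K hq with hA | hP
    · exact hA
    · exfalso
      have := natDegree_eq_of_second_generator_of_natDegree_lt K hq h2 hm (hP.2 m hmem hm.ne_zero) hmem hg hgA
      omega

end Summit.Ventures.HSemireg.Wedge.HankelOuter
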